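import Summits.Ventures.HodgeRepro2.T6A2SegreGlue
import Summits.Ventures.HodgeRepro2.T6A2WeilTensor

/-!
# T6A2SegreProjective — a product of projective schemes is projective

Cell pub-hodge-repro2, Tier 6 (README §10), seat t6-p2 (A2 owner; gen 14, custodial). THE KERNEL DISCHARGE
OF THE A2 DISPLAY `Hyp.Hartshorne1977_productProjective` (T6A2HypHost): for the host's `projectiveSpace n k =
Proj k[X₀..Xₙ]` over `Spec k`, the Segre morphism of T6A2SegreGlue (indices `Fin (n + 1) × Fin (m + 1) ≃
Fin (nm + n + m + 1)`) is a closed immersion `ℙⁿ ⊗ ℙᵐ ⟶ ℙ^{nm+n+m}` over `Spec k` (`segreOver`); a product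
`X ⊗ Y` of two schemes projective over `k` (closed immersions `X ⟶ ℙⁿ`, `Y ⟶ ℙᵐ`) is projective: the
product of the two closed immersions (stable under base change and composition) followed by the Segre
embedding (`isProjectiveOver_tensor`). Consequences: `Hyp.Hartshorne1977_productProjective_holds` and the
host's own unproved named Prop `IsSmoothProjective.tensor` (`Hyp.isSmoothProjective_tensor_holds`, through
T6A2WeilTensor's `WeilInst.tensor_of_display`). Mathlib + host-api only; no display consumed; no `sorry`;
standard axioms. §8(d): uses an L-value-free non-vanishing device: NO.
Filed in Tier-6 WAVE 1 (2026-08-26) as p440815 (definition lane, ACCEPTED 11:25Z, commit 90a524a26855); this v2 differs from the filed bytes in this module docstring only (the staged-record wording dropped).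
-/

namespace Summit.Ventures.HodgeRepro2.T6.A2Segre

open MvPolynomial HomogeneousLocalization CategoryTheory CategoryTheory.Limits AlgebraicGeometry
  HostAPI.Carriers.AlgebraicGeometry.Motives Summit.Ventures.HodgeRepro2.T6.A2Surface

open scoped MonoidalCategory

attribute [local instance] MvPolynomial.gradedAlgebra

variable (k : Type) [Field k]

/-- the host's `projectiveSpace n k` is `Proj k[X₀..Xₙ]` with the structure map `structMap` -/
theorem projectiveSpace_hom (n : ℕ) : (projectiveSpace n k).hom = structMap k (Fin (n + 1)) := rfl

/-- the index identification `Fin (n + 1) × Fin (m + 1) ≃ Fin (nm + n + m + 1)` of the Segre embedding -/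
def segreIndex (n m : ℕ) : Fin (n + 1) × Fin (m + 1) ≃ Fin (n * m + n + m + 1) :=
  finProdFinEquiv.trans (finCongr (by ring))

/-- **THE SEGRE EMBEDDING** `ℙⁿ ⊗ ℙᵐ ⟶ ℙ^{nm+n+m}` as a morphism of schemes over `Spec k` -/
noncomputable def segreOver (n m : ℕ) :
    projectiveSpace n k ⊗ projectiveSpace m k ⟶ projectiveSpace (n * m + n + m) k :=
  Over.homMk (segre k (segreIndex n m)) (by exact segre_structMap k (segreIndex n m))

/-- the underlying morphism of schemes of `segreOver` is `segre` -/
theorem segreOver_left (n m : ℕ) : (segreOver k n m).left = segre k (segreIndex n m) := rfl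

/-- the Segre embedding is a closed immersion -/
theorem isClosedImmersion_segreOver_left (n m : ℕ) : IsClosedImmersion (segreOver k n m).left :=
  isClosedImmersion_segre k (segreIndex n m)

/-- **A PRODUCT OF TWO SCHEMES PROJECTIVE OVER `k` IS PROJECTIVE OVER `k`** (the host's
`IsProjectiveOver`): the product of the two closed immersions into projective spaces followed by the
Segre embedding. -/
theorem isProjectiveOver_tensor {X Y : SchemeOver k} (hX : IsProjectiveOver X)
    (hY : IsProjectiveOver Y) : IsProjectiveOver (X ⊗ Y) := by
  obtain ⟨n, ιX, hιX⟩ := hX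
  obtain ⟨m, ιY, hιY⟩ := hY
  refine ⟨n * m + n + m, (ιX ⊗ₘ ιY) ≫ segreOver k n m, ?_⟩
  rw [Over.comp_left]
  haveI : IsClosedImmersion (ιX ⊗ₘ ιY).left := by
    rw [Over.tensorHom_left]
    exact MorphismProperty.pullbackMap (P := @IsClosedImmersion) hιX hιY (Over.w ιX).symm
      (Over.w ιY).symm
  haveI := isClosedImmersion_segreOver_left k n m
  infer_instance

end Summit.Ventures.HodgeRepro2.T6.A2Segre

namespace Summit.Ventures.HodgeRepro2.T6

open HostAPI.Carriers.AlgebraicGeometry.Motives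

/-- **THE A2 DISPLAY `Hyp.Hartshorne1977_productProjective` IS A THEOREM** (Mathlib + host-api only). -/
theorem Hyp.Hartshorne1977_productProjective_holds : Hyp.Hartshorne1977_productProjective :=
  fun _ _ hX hY => A2Segre.isProjectiveOver_tensor ℂ hX hY

/-- the host's unproved named Prop `IsSmoothProjective.tensor` (Varieties.lean), for every `n m X Y`,
discharged through T6A2WeilTensor -/
theorem Hyp.isSmoothProjective_tensor_holds (n m : ℕ) (X Y : SchemeOver ℂ) :
    IsSmoothProjective.tensor (n := n) (m := m) (X := X) (Y := Y) :=
  WeilInst.tensor_of_display Hyp.Hartshorne1977_productProjective_holds n m X Y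

end Summit.Ventures.HodgeRepro2.T6
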